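import Summits.QuantumFields.BalabanUV.Beta.GAN24.CubicSectorCurrentSym
import Summits.QuantumFields.BalabanUV.Beta.GAN24.CubicSectorCurrentExpansionOfDecays
import Summits.QuantumFields.BalabanUV.Beta.GAN24.ColumnResponseOfWardLetters

/-!
# `BalabanUV.Beta.GAN24.CubicSectorCurrentSymOfWardLetters` — binder row G-an2-4 ∕ (CONV-C), TRANSFER-III, the KERNEL-GENERIC twin of this lineage's (A)-tower induction step
# `CubicSectorCurrentExpansion` §4 + `CubicSectorCurrentSym` (g69): **IF EVERY SLOT↔LEG-SYMMETRISED CLASS-WEIGHTED TWO-LEG CURRENT OF THE TABLE FAMILY `S` VANISHES AT EVERY FREE LEG, THEN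
# SO DOES EVERY SUCH CURRENT OF ITS CUBIC SECTOR `e3OfK Lc X S` THROUGH ANY DECAYING TAME-SYMMETRIC KERNEL `X` WHOSE COLUMN RESPONSES TO BOUNDED SINGLE-COORDINATE SOURCES ARE THE
# WARD SHAPES (R-H)(R-M)** — and the (III′) instance `X := GcombSh Lc j` (an2's comb-chart resolvents of row D1's literal of record) by leaf-02 g78's (A) `ColumnResponseOfWardLetters` §4.

NOT IN PRINT; OUR BOOKKEEPING ([folklore] bookkeeping BY NAME over this lineage's g69 `CubicSectorCurrentExpansion` §1–§3 (`e3OfK_inl_inl_eq_neg_comp`, `tsum_slot_comp_right`,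
`tsum_midleg_freeleg_comm`), `ExitFaceCurrentDescent` (`abs_legResponse_le`, `tsum_midleg_slot_comm`, `tsum_leg_comp_eq_neg_fieldResponse`), `ExitFaceCurrentDivBlockSum.tsum_leg_slot_comm`,
`ExitFaceCurrentSectorSplit.abs_tsum_slot_locStencil_le`, `SlotWeightedVertex.tsum_slotWeight_vertexOfK`, `ExitFaceCurrentTowerStep.sum_tsum_ite_dir`, g68's `CoordinateProfileResponses.face_mul_eq_const_add_grad ∕
abs_Psi_le`, an4's `OneStepKernelFamily.vertexFamily_vertexOfK ∕ colH`, an5's `StepReflectionRec.e3OfK_inl_inr`; the instance over leaf-02 g78's `ColumnResponseOfWardLetters.tsum_coord_colH_GcombSh ∕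
tsum_coord_colM_GcombSh` and an2's `CombChartStepJets.decays_GcombSh` ∕ `CombChartWardSockets.trK_GcombSh ∕ GcombSh_inr_inr_off`; G-an2-4 CRUX TEAM (2), leaf prover `b2b-balaban-gan24-formalise-leaf-04`,
gen 77).  HONEST FRAMING (cell contract, verbatim): «discharging `BetaPertH` makes Bałaban's UV stability UNCONDITIONAL — a real constructive-QFT result; it is NOT the continuum limit and NOT the
Clay problem.»  HONEST DEPENDENCY (verbatim): «continuum YM on T⁴ ⇐ BetaPertH ∧ nine spine estimates (0/9 proved); BetaPertH ⇐ (D1) ∧ (D4) ∧ CAP+tail; G-an2-4 gates asym, D1 and NE2/3/4.»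

WHY.  The g69 step read the dressed comb kernel `G_j = coDressKBmAt ρ Lc (KInvStep Lc j)` through exactly four properties: its decay, its tame symmetry `trK G_j = sgnK G_j` (for the left
contraction `ExitFaceCurrentDescent.tsum_leg_comp_eq_neg_fieldResponse`), and the two RESPONSES of a bounded single-coordinate source — the `ℋ`-column response is the Ward shape
`cH·𝟙[κ = a ∧ u_a ≡ −1]·f((blk u)_a)` and the multiplier response is `0` (g68's `CoordinateProfileResponses`).  At row D1's literal of record (III′) the cubic sector of
`SrecOf d Lc V H (GcombSh Lc)` reads an2's comb-chart resolvent `G′_j = GcombSh Lc j`, for which leaf-02 g78's (A) states the same two responses from an2's column Ward letters.  So the step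
is stated ONCE over the letters and instantiated.

CONVENTION (weighted leg FIRST, free leg `(p, a)` SECOND): `P_T[s,h](p,a) := Σ'_q h(q_β)·Σ'_u s(u_ν)·T ν u q p (inl β) a + Σ'_q s(q_ν)·Σ'_u h(u_β)·T β u q p (inl ν) a`.

WHAT ([folklore]; generic `d`, `[NeZero Lc]`, ANY local table family `S`, ANY kernel `X` with (DG) `Decays X CK δK`, (SG) `trK X = sgnK X`; 0 `def`, 0 cited facts, 0 `def … : Prop`, 0 sorry;
§1 = the sibling file `CubicSectorCurrentExpansionOfDecays.faceSlot_current_eq_tsum_freeLeg_of_decays`, g69's expansion with `G_j ↦ X`): §2 **`sym_e3OfK_of_wardLetters`** — under the two response letters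
(R-H) `∀ a f (bdd) κ u, Σ'_y f(y_a)·colH X Lc a y κ u = cH·𝟙[κ = a ∧ u_a % Lc = Lc−1]·f((blk Lc u)_a)` and (R-M) `∀ a f (bdd) m q, Σ'_y f(y_a)·X q (Lc•y) (inr m) (inr a) = 0`:
hypothesis = for all face-supported class data `(c₁,Ψ₁)`, `(c₂,Ψ₂)` and all free legs `(p,a)`, `P_S[c₂+dΨ₂, c₁+dΨ₁](p,a) = 0`; conclusion = for all bounded class data `(c,Φ)`, `(c′,Φ′)` and all free legs
`(y,a′)`, `P_{e3OfK Lc X S}[c′+dΦ′, c+dΦ](y,a′) = 0` (g69's proof with the constants `A := cH·c`, `Ψ(n) := (−(A·Lc⁻¹)·(n mod Lc) + cH·Φ(n div Lc))∕M`); §3 THE (III′) INSTANCE: `tsum_coord_mm_GcombSh`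
((R-M) for `G′_j` at EVERY first leg: (A)'s `tsum_coord_colM_GcombSh` on the coarse lattice, an2's `GcombSh_inr_inr_off` off it) and **`sym_e3OfK_GcombSh_of_sym`** (every `j`).  Asserts NO value of
Bałaban's tables; discharges NOTHING of (C)sym ∕ (hW, hWall) ∕ (hS, hSall); NEVER «G-an2-4 closed» as (CONV-C); NOT D1, NOT `BetaPertH`, NOT continuum, NOT Clay.  2026-08-25; no existing file touched.
-/

noncomputable section

open Finset
open scoped BigOperators
open Literature.MathematicalPhysics.QuantumFieldTheory
open Literature.MathematicalPhysics.QuantumFieldTheory.Balaban1983to89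
open Literature.MathematicalPhysics.QuantumFieldTheory.Balaban1983to89.Beta
open B12Sec2to5 (l1 l1_nonneg)
open ExpKernelCalculus (Site MKer Decays)
open AffineAveraging (box toSite)
open AveragingContours (blk)
open Literature.Probability.LatticeModels (Torus.proj)
open LatticeForm (quo)
open OneStepResolventKernel (Fib LocStencil eq_zsmul_quo_of_proj)
open OneStepKernelFamily (colH)
open SecondOrderResponse (colM)
open Summit.QuantumFields.BalabanUV.Beta.TameKernelCalculus (trK)
open Summit.QuantumFields.BalabanUV.Beta.BorderedHessian (sgnK stepScale)
open Summit.QuantumFields.BalabanUV.Beta.SpineRooted (e3OfK e3OfK_apply e3OfK_inl_inr)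
open Summit.QuantumFields.BalabanUV.Beta.CombChartStepJets (GcombSh decays_GcombSh)
open Summit.QuantumFields.BalabanUV.Beta.CombChartWardSockets (trK_GcombSh GcombSh_inr_inr_off)
open Summit.QuantumFields.BalabanUV.Beta.GAN24.ExitFaceCurrentTowerStep (sum_tsum_ite_dir)
open Summit.QuantumFields.BalabanUV.Beta.GAN24.CoordinateProfileResponses (face_mul_eq_const_add_grad abs_Psi_le)
open Summit.QuantumFields.BalabanUV.Beta.GAN24.ColumnResponseOfWardLetters (tsum_coord_colH_GcombSh tsum_coord_colM_GcombSh)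

open Summit.QuantumFields.BalabanUV.Beta.GAN24.CubicSectorCurrentExpansionOfDecays (faceSlot_current_eq_tsum_freeLeg_of_decays)

namespace Summit.QuantumFields.BalabanUV.Beta.GAN24.CubicSectorCurrentSymOfWardLetters

variable {d : ℕ} {Lc : ℕ} [NeZero Lc] {S : Fin (d + 1) → (Fin (d + 1) → ℤ) → MKer (d + 1) (Fib d)} {Cs δs : ℝ} {X : MKer (d + 1) (Fib d)} {CK δK : ℝ}

/-! ## §2 The induction step over the response letters (R-H)(R-M) -/

set_option maxHeartbeats 400000 in
/-- [folklore] **THE (A)-TOWER INDUCTION STEP OVER THE WARD RESPONSE LETTERS**: for ANY decaying tame-symmetric kernel `X` whose `ℋ`-column response to a bounded single-coordinate source is the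
Ward shape (R-H) with constant `cH` and whose multiplier response is `0` (R-M), the vanishing of all slot↔leg-symmetrised class-weighted two-leg currents at every free leg passes from the table
family `S` (face-supported class data, ALL free legs) to its cubic sector `e3OfK Lc X S` (all bounded class data, all free legs) — g69's `CubicSectorCurrentSym.sym_e3OfK_of_sym` with
`G_j ↦ X`, constants `A := cH·c`, `Ψ(n) := (−(A·Lc⁻¹)·(n mod Lc) + cH·Φ(n div Lc))∕M`. -/
theorem sym_e3OfK_of_wardLetters (hG : Decays X CK δK) (hδK : 0 < δK) (hKt : trK X = sgnK X) {cH : ℝ}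
    (hRH : ∀ (a : Fin (d + 1)) (f : ℤ → ℝ) (B : ℝ), (∀ s, |f s| ≤ B) → ∀ (κ : Fin (d + 1)) (u : Site (d + 1)),
      ∑' y : Site (d + 1), f (y a) * colH X Lc a y κ u = cH * (if κ = a ∧ u a % (Lc : ℤ) = (Lc : ℤ) - 1 then f (blk Lc u a) else 0))
    (hRM : ∀ (a : Fin (d + 1)) (f : ℤ → ℝ) (B : ℝ), (∀ s, |f s| ≤ B) → ∀ (m : Fin (d + 1)) (q : Site (d + 1)),
      ∑' y : Site (d + 1), f (y a) * X q ((Lc : ℤ) • y) (Sum.inr m) (Sum.inr a) = 0)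
    (hS : LocStencil S Cs δs) (hδs : 0 < δs) (ν β : Fin (d + 1))
    (hyp : ∀ (c₁ : ℝ) (Ψ₁ : ℤ → ℝ) (B₁ : ℝ), (∀ s, |Ψ₁ s| ≤ B₁) → (∀ n : ℤ, n % (Lc : ℤ) ≠ (Lc : ℤ) - 1 → c₁ + (Ψ₁ (n + 1) - Ψ₁ n) = 0) →
      ∀ (c₂ : ℝ) (Ψ₂ : ℤ → ℝ) (B₂ : ℝ), (∀ s, |Ψ₂ s| ≤ B₂) → (∀ n : ℤ, n % (Lc : ℤ) ≠ (Lc : ℤ) - 1 → c₂ + (Ψ₂ (n + 1) - Ψ₂ n) = 0) →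
      ∀ (p : Site (d + 1)) (a : Fib d),
        (∑' q : Site (d + 1), (c₁ + (Ψ₁ (q β + 1) - Ψ₁ (q β))) * ∑' u : Site (d + 1), (c₂ + (Ψ₂ (u ν + 1) - Ψ₂ (u ν))) * S ν u q p (Sum.inl β) a) +
          ∑' q : Site (d + 1), (c₂ + (Ψ₂ (q ν + 1) - Ψ₂ (q ν))) * ∑' u : Site (d + 1), (c₁ + (Ψ₁ (u β + 1) - Ψ₁ (u β))) * S β u q p (Sum.inl ν) a = 0)
    (c : ℝ) (Φ : ℤ → ℝ) {B : ℝ} (hΦ : ∀ s, |Φ s| ≤ B) (c' : ℝ) (Φ' : ℤ → ℝ) {B' : ℝ} (hΦ' : ∀ s, |Φ' s| ≤ B') (y : Site (d + 1)) (a' : Fib d) :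
    (∑' w : Site (d + 1), (c + (Φ (w β + 1) - Φ (w β))) * ∑' t : Site (d + 1), (c' + (Φ' (t ν + 1) - Φ' (t ν))) *
        e3OfK Lc X S ν t w y (Sum.inl β) a') +
      ∑' w : Site (d + 1), (c' + (Φ' (w ν + 1) - Φ' (w ν))) * ∑' t : Site (d + 1), (c + (Φ (t β + 1) - Φ (t β))) *
        e3OfK Lc X S β t w y (Sum.inl ν) a' = 0 := by
  classical
  rcases a' with μ | m
  swap
  · simp only [e3OfK_inl_inr Lc, mul_zero, tsum_zero, add_zero]
  have hB : 0 ≤ B := (abs_nonneg _).trans (hΦ 0)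
  have hB' : 0 ≤ B' := (abs_nonneg _).trans (hΦ' 0)
  -- rescaled weights with `|·| ≤ 1`
  set Mρ : ℝ := |c| + (B + B) + 1 with hMρ
  set Mσ : ℝ := |c'| + (B' + B') + 1 with hMσ
  have hMρ0 : 0 < Mρ := by positivity
  have hMσ0 : 0 < Mσ := by positivity
  set f₁ : ℤ → ℝ := fun n => (c + (Φ (n + 1) - Φ n)) / Mρ with hf₁
  set f₂ : ℤ → ℝ := fun n => (c' + (Φ' (n + 1) - Φ' n)) / Mσ with hf₂
  set ρ₁ : Site (d + 1) → ℝ := fun w => (c + (Φ (w β + 1) - Φ (w β))) / Mρ with hρ₁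
  set σ₁ : Site (d + 1) → ℝ := fun t => (c' + (Φ' (t ν + 1) - Φ' (t ν))) / Mσ with hσ₁
  have hf₁b : ∀ n, |f₁ n| ≤ 1 := by
    intro n
    rw [hf₁, abs_div, abs_of_pos hMρ0, div_le_one hMρ0]
    refine (abs_add_le _ _).trans ?_
    have := (abs_sub (Φ (n + 1)) (Φ n)).trans (add_le_add (hΦ _) (hΦ _))
    linarith
  have hf₂b : ∀ n, |f₂ n| ≤ 1 := by
    intro n
    rw [hf₂, abs_div, abs_of_pos hMσ0, div_le_one hMσ0]
    refine (abs_add_le _ _).trans ?_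
    have := (abs_sub (Φ' (n + 1)) (Φ' n)).trans (add_le_add (hΦ' _) (hΦ' _))
    linarith
  have hρb : ∀ w, |ρ₁ w| ≤ 1 := fun w => hf₁b (w β)
  have hσb : ∀ t, |σ₁ t| ≤ 1 := fun t => hf₂b (t ν)
  -- zero multiplier responses of both rescaled data ((R-M))
  have hMρr : ∀ (m : Fin (d + 1)) (q : Site (d + 1)),
      ∑' w : Site (d + 1), ρ₁ w * X q ((Lc : ℤ) • w) (Sum.inr m) (Sum.inr β) = 0 := fun m q => hRM β f₁ 1 hf₁b m q
  have hMσr : ∀ (m : Fin (d + 1)) (q : Site (d + 1)),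
      ∑' t : Site (d + 1), σ₁ t * X q ((Lc : ℤ) • t) (Sum.inr m) (Sum.inr ν) = 0 := fun m q => hRM ν f₂ 1 hf₂b m q
  -- the responses of the rescaled data, explicitly (same class one level down, supported on the exit faces)
  set A₁ : ℝ := cH * c with hA₁
  set A₂ : ℝ := cH * c' with hA₂
  set Ψ₁ : ℤ → ℝ := fun n => (-(A₁ * (Lc : ℝ)⁻¹) * (((n % (Lc : ℤ) : ℤ) : ℝ)) + cH * Φ (n / (Lc : ℤ))) / Mρ with hΨ₁
  set Ψ₂ : ℤ → ℝ := fun n => (-(A₂ * (Lc : ℝ)⁻¹) * (((n % (Lc : ℤ) : ℤ) : ℝ)) + cH * Φ' (n / (Lc : ℤ))) / Mσ with hΨ₂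
  have hΨ₁b : ∀ s, |Ψ₁ s| ≤ (|A₁| + |cH| * B) / Mρ := fun s => by
    rw [hΨ₁, abs_div, abs_of_pos hMρ0]
    exact div_le_div_of_nonneg_right (abs_Psi_le (Lc := Lc) A₁ cH Φ hΦ s) hMρ0.le
  have hΨ₂b : ∀ s, |Ψ₂ s| ≤ (|A₂| + |cH| * B') / Mσ := fun s => by
    rw [hΨ₂, abs_div, abs_of_pos hMσ0]
    exact div_le_div_of_nonneg_right (abs_Psi_le (Lc := Lc) A₂ cH Φ' hΦ' s) hMσ0.le
  -- the Ward shape of the rescaled `ℋ`-response IS `constant + gradient` one level down (g68's `face_mul_eq_const_add_grad`)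
  have key1 : ∀ n : ℤ, cH * (if n % (Lc : ℤ) = (Lc : ℤ) - 1 then f₁ (n / (Lc : ℤ)) else 0) = A₁ * (Lc : ℝ)⁻¹ / Mρ + (Ψ₁ (n + 1) - Ψ₁ n) := by
    intro n
    have hf := face_mul_eq_const_add_grad (Lc := Lc) A₁ cH Φ n
    by_cases hn : n % (Lc : ℤ) = (Lc : ℤ) - 1
    · rw [if_pos hn] at hf ⊢
      simp only [hΨ₁, hf₁]
      rw [← sub_div, ← add_div, ← hf, hA₁]
      field_simp
    · rw [if_neg hn] at hf ⊢
      simp only [hΨ₁]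
      rw [mul_zero, ← sub_div, ← add_div, ← hf, zero_div]
  have key2 : ∀ n : ℤ, cH * (if n % (Lc : ℤ) = (Lc : ℤ) - 1 then f₂ (n / (Lc : ℤ)) else 0) = A₂ * (Lc : ℝ)⁻¹ / Mσ + (Ψ₂ (n + 1) - Ψ₂ n) := by
    intro n
    have hf := face_mul_eq_const_add_grad (Lc := Lc) A₂ cH Φ' n
    by_cases hn : n % (Lc : ℤ) = (Lc : ℤ) - 1
    · rw [if_pos hn] at hf ⊢
      simp only [hΨ₂, hf₂]
      rw [← sub_div, ← add_div, ← hf, hA₂]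
      field_simp
    · rw [if_neg hn] at hf ⊢
      simp only [hΨ₂]
      rw [mul_zero, ← sub_div, ← add_div, ← hf, zero_div]
  have hΨ₁f : ∀ n : ℤ, n % (Lc : ℤ) ≠ (Lc : ℤ) - 1 → A₁ * (Lc : ℝ)⁻¹ / Mρ + (Ψ₁ (n + 1) - Ψ₁ n) = 0 := fun n hn => by
    rw [← key1 n, if_neg hn, mul_zero]
  have hΨ₂f : ∀ n : ℤ, n % (Lc : ℤ) ≠ (Lc : ℤ) - 1 → A₂ * (Lc : ℝ)⁻¹ / Mσ + (Ψ₂ (n + 1) - Ψ₂ n) = 0 := fun n hn => by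
    rw [← key2 n, if_neg hn, mul_zero]
  have eH : ∀ (κ₂ : Fin (d + 1)) (q : Site (d + 1)),
      ∑' w : Site (d + 1), ρ₁ w * colH X Lc β w κ₂ q =
        if κ₂ = β then A₁ * (Lc : ℝ)⁻¹ / Mρ + (Ψ₁ (q β + 1) - Ψ₁ (q β)) else 0 := by
    intro κ₂ q
    have h : ∑' w : Site (d + 1), ρ₁ w * colH X Lc β w κ₂ q = cH * (if κ₂ = β ∧ q β % (Lc : ℤ) = (Lc : ℤ) - 1 then f₁ (blk Lc q β) else 0) :=
      hRH β f₁ 1 hf₁b κ₂ q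
    rw [h]
    by_cases hκ : κ₂ = β
    · simp only [hκ, true_and, if_true]
      exact key1 (q β)
    · rw [if_neg hκ]
      simp only [hκ, false_and, if_false, mul_zero]
  have eσ : ∀ (κ₃ : Fin (d + 1)) (u : Site (d + 1)),
      ∑' t : Site (d + 1), σ₁ t * colH X Lc ν t κ₃ u =
        if κ₃ = ν then A₂ * (Lc : ℝ)⁻¹ / Mσ + (Ψ₂ (u ν + 1) - Ψ₂ (u ν)) else 0 := by
    intro κ₃ u
    have h : ∑' t : Site (d + 1), σ₁ t * colH X Lc ν t κ₃ u = cH * (if κ₃ = ν ∧ u ν % (Lc : ℤ) = (Lc : ℤ) - 1 then f₂ (blk Lc u ν) else 0) :=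
      hRH ν f₂ 1 hf₂b κ₃ u
    rw [h]
    by_cases hκ : κ₃ = ν
    · simp only [hκ, true_and, if_true]
      exact key2 (u ν)
    · rw [if_neg hκ]
      simp only [hκ, false_and, if_false, mul_zero]
  -- the two expansions (free leg `(y, inl μ)` second) and their sum
  have E1 := faceSlot_current_eq_tsum_freeLeg_of_decays (d := d) hG hδK hKt hS hδs hσb hρb ν β hMρr y μ
  have E2 := faceSlot_current_eq_tsum_freeLeg_of_decays (d := d) hG hδK hKt hS hδs hρb hσb β ν hMσr y μ
  -- the level-j currents, collapsed: they are the two halves of `P_S[s', h']`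
  have eT1 : ∀ (p : Site (d + 1)) (a : Fib d),
      ∑ κ₂ : Fin (d + 1), ∑' q : Site (d + 1), (∑' w : Site (d + 1), ρ₁ w * colH X Lc β w κ₂ q) *
          ∑ κ₃ : Fin (d + 1), ∑' u : Site (d + 1), (∑' t : Site (d + 1), σ₁ t * colH X Lc ν t κ₃ u) *
            S κ₃ u q p (Sum.inl κ₂) a =
      ∑' q : Site (d + 1), (A₁ * (Lc : ℝ)⁻¹ / Mρ + (Ψ₁ (q β + 1) - Ψ₁ (q β))) *
          ∑' u : Site (d + 1), (A₂ * (Lc : ℝ)⁻¹ / Mσ + (Ψ₂ (u ν + 1) - Ψ₂ (u ν))) * S ν u q p (Sum.inl β) a := by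
    intro p a
    simp only [eH, eσ]
    rw [sum_tsum_ite_dir β (fun q => A₁ * (Lc : ℝ)⁻¹ / Mρ + (Ψ₁ (q β + 1) - Ψ₁ (q β)))]
    refine tsum_congr fun q => ?_
    rw [sum_tsum_ite_dir ν (fun u => A₂ * (Lc : ℝ)⁻¹ / Mσ + (Ψ₂ (u ν + 1) - Ψ₂ (u ν)))]
  have eT2 : ∀ (p : Site (d + 1)) (a : Fib d),
      ∑ κ₂ : Fin (d + 1), ∑' q : Site (d + 1), (∑' w : Site (d + 1), σ₁ w * colH X Lc ν w κ₂ q) *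
          ∑ κ₃ : Fin (d + 1), ∑' u : Site (d + 1), (∑' t : Site (d + 1), ρ₁ t * colH X Lc β t κ₃ u) *
            S κ₃ u q p (Sum.inl κ₂) a =
      ∑' q : Site (d + 1), (A₂ * (Lc : ℝ)⁻¹ / Mσ + (Ψ₂ (q ν + 1) - Ψ₂ (q ν))) *
          ∑' u : Site (d + 1), (A₁ * (Lc : ℝ)⁻¹ / Mρ + (Ψ₁ (u β + 1) - Ψ₁ (u β))) * S β u q p (Sum.inl ν) a := by
    intro p a
    simp only [eH, eσ]
    rw [sum_tsum_ite_dir ν (fun q => A₂ * (Lc : ℝ)⁻¹ / Mσ + (Ψ₂ (q ν + 1) - Ψ₂ (q ν)))]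
    refine tsum_congr fun q => ?_
    rw [sum_tsum_ite_dir β (fun u => A₁ * (Lc : ℝ)⁻¹ / Mρ + (Ψ₁ (u β + 1) - Ψ₁ (u β)))]
  have key : ∀ (p : Site (d + 1)) (a : Fib d),
      (∑ κ₂ : Fin (d + 1), ∑' q : Site (d + 1), (∑' w : Site (d + 1), ρ₁ w * colH X Lc β w κ₂ q) *
          ∑ κ₃ : Fin (d + 1), ∑' u : Site (d + 1), (∑' t : Site (d + 1), σ₁ t * colH X Lc ν t κ₃ u) *
            S κ₃ u q p (Sum.inl κ₂) a) +
        ∑ κ₂ : Fin (d + 1), ∑' q : Site (d + 1), (∑' w : Site (d + 1), σ₁ w * colH X Lc ν w κ₂ q) *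
          ∑ κ₃ : Fin (d + 1), ∑' u : Site (d + 1), (∑' t : Site (d + 1), ρ₁ t * colH X Lc β t κ₃ u) *
            S κ₃ u q p (Sum.inl κ₂) a = 0 := by
    intro p a
    rw [eT1, eT2]
    exact hyp (A₁ * (Lc : ℝ)⁻¹ / Mρ) Ψ₁ _ hΨ₁b hΨ₁f (A₂ * (Lc : ℝ)⁻¹ / Mσ) Ψ₂ _ hΨ₂b hΨ₂f p a
  -- undo the rescaling and conclude
  have e : ∀ (κ τ : Fin (d + 1)) (g₁ g₂ : Site (d + 1) → ℝ) (M₁ M₂ : ℝ), M₁ ≠ 0 → M₂ ≠ 0 →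
      ∑' w : Site (d + 1), g₁ w * ∑' t : Site (d + 1), g₂ t * e3OfK Lc X S κ t w y (Sum.inl τ) (Sum.inl μ) =
      M₁ * (M₂ * ∑' w : Site (d + 1), (g₁ w / M₁) * ∑' t : Site (d + 1), (g₂ t / M₂) * e3OfK Lc X S κ t w y (Sum.inl τ) (Sum.inl μ)) := by
    intro κ τ g₁ g₂ M₁ M₂ h1 h2
    have e1 : ∀ w : Site (d + 1), g₁ w = M₁ * (g₁ w / M₁) := fun w => by field_simp
    have e2 : ∀ t : Site (d + 1), g₂ t = M₂ * (g₂ t / M₂) := fun t => by field_simp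
    have e3 : ∀ w : Site (d + 1), ∑' t : Site (d + 1), g₂ t * e3OfK Lc X S κ t w y (Sum.inl τ) (Sum.inl μ) =
        M₂ * ∑' t : Site (d + 1), (g₂ t / M₂) * e3OfK Lc X S κ t w y (Sum.inl τ) (Sum.inl μ) := by
      intro w
      rw [← tsum_mul_left]
      exact tsum_congr fun t => by rw [← mul_assoc, ← e2 t]
    calc _ = ∑' w : Site (d + 1), M₁ * (M₂ * ((g₁ w / M₁) * ∑' t : Site (d + 1), (g₂ t / M₂) *
          e3OfK Lc X S κ t w y (Sum.inl τ) (Sum.inl μ))) :=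
          tsum_congr fun w => by rw [e3 w]; nth_rewrite 1 [e1 w]; ring
      _ = _ := by rw [tsum_mul_left, tsum_mul_left]
  rw [e ν β _ _ Mρ Mσ hMρ0.ne' hMσ0.ne', e β ν _ _ Mσ Mρ hMσ0.ne' hMρ0.ne']
  show Mρ * (Mσ * ∑' w : Site (d + 1), ρ₁ w * ∑' t : Site (d + 1), σ₁ t * e3OfK Lc X S ν t w y (Sum.inl β) (Sum.inl μ)) +
    Mσ * (Mρ * ∑' w : Site (d + 1), σ₁ w * ∑' t : Site (d + 1), ρ₁ t * e3OfK Lc X S β t w y (Sum.inl ν) (Sum.inl μ)) = 0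
  rw [E1.2, E2.2, ← mul_assoc, ← mul_assoc, mul_comm Mσ Mρ, ← mul_add, ← (E1.1).tsum_add E2.1]
  rw [show (∑' p : Site (d + 1), ((∑ a : Fib d,
        (∑ κ₂ : Fin (d + 1), ∑' q : Site (d + 1), (∑' w : Site (d + 1), ρ₁ w * colH X Lc β w κ₂ q) *
          ∑ κ₃ : Fin (d + 1), ∑' u : Site (d + 1), (∑' t : Site (d + 1), σ₁ t * colH X Lc ν t κ₃ u) *
            S κ₃ u q p (Sum.inl κ₂) a) * X p ((Lc : ℤ) • y) a (Sum.inr μ)) +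
      ∑ a : Fib d,
        (∑ κ₂ : Fin (d + 1), ∑' q : Site (d + 1), (∑' w : Site (d + 1), σ₁ w * colH X Lc ν w κ₂ q) *
          ∑ κ₃ : Fin (d + 1), ∑' u : Site (d + 1), (∑' t : Site (d + 1), ρ₁ t * colH X Lc β t κ₃ u) *
            S κ₃ u q p (Sum.inl κ₂) a) * X p ((Lc : ℤ) • y) a (Sum.inr μ))) = 0 from ?_, mul_zero]
  refine (tsum_congr fun p => ?_).trans tsum_zero
  rw [← Finset.sum_add_distrib]
  refine Finset.sum_eq_zero fun a _ => ?_
  rw [← add_mul, key p a, zero_mul]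


/-! ## §3 The (III′) instance: an2's comb-chart resolvents `G′_j = GcombSh Lc j` -/

section CombStep

variable (Lc)

/-- NOT IN PRINT; OUR BOOKKEEPING.  **(R-M) FOR `G′_j` AT EVERY FIRST LEG**: `Σ'_y f(y_a)·GcombSh Lc j q (Lc•y) (inr m) (inr a) = 0` (bounded `f`, EVERY `q`) — on the coarse lattice this is leaf-02 g78's
(A) `tsum_coord_colM_GcombSh` (the multiplier column), off it an2's `GcombSh_inr_inr_off` (the `mm` block of `G′_j` lives on the coarse lattice). -/
theorem tsum_coord_mm_GcombSh (j : ℕ) (a : Fin (d + 1)) (f : ℤ → ℝ) {B : ℝ} (hf : ∀ s, |f s| ≤ B) (m : Fin (d + 1)) (q : Site (d + 1)) :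
    ∑' y : Site (d + 1), f (y a) * GcombSh (d := d) Lc j q ((Lc : ℤ) • y) (Sum.inr m) (Sum.inr a) = 0 := by
  by_cases hq : Torus.proj Lc q = 0
  · have hqv := eq_zsmul_quo_of_proj (N := Lc) hq
    have h := tsum_coord_colM_GcombSh Lc j a f hf m (quo Lc q)
    simp only [colM] at h
    rw [← hqv] at h
    exact h
  · simp only [GcombSh_inr_inr_off j q hq, mul_zero, tsum_zero]

variable {Lc}

/-- NOT IN PRINT; OUR BOOKKEEPING.  **THE (A)-TOWER INDUCTION STEP AT ROW D1's LITERAL OF RECORD (III′)** — §2 at `X := GcombSh Lc j` (every `j`; (DG) `decays_GcombSh`, (SG) `trK_GcombSh`, (R-H)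
leaf-02 g78's `tsum_coord_colH_GcombSh` with `cH_j = (stepScale d Lc j·Lc^{d+1})⁻¹`, (R-M) `tsum_coord_mm_GcombSh`): the cubic sector `e3OfK Lc (GcombSh Lc j) S` of ANY local table family `S`
inherits the vanishing of all slot↔leg-symmetrised class-weighted currents at every free leg. -/
theorem sym_e3OfK_GcombSh_of_sym (j : ℕ) (hS : LocStencil S Cs δs) (hδs : 0 < δs) (ν β : Fin (d + 1))
    (hyp : ∀ (c₁ : ℝ) (Ψ₁ : ℤ → ℝ) (B₁ : ℝ), (∀ s, |Ψ₁ s| ≤ B₁) → (∀ n : ℤ, n % (Lc : ℤ) ≠ (Lc : ℤ) - 1 → c₁ + (Ψ₁ (n + 1) - Ψ₁ n) = 0) →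
      ∀ (c₂ : ℝ) (Ψ₂ : ℤ → ℝ) (B₂ : ℝ), (∀ s, |Ψ₂ s| ≤ B₂) → (∀ n : ℤ, n % (Lc : ℤ) ≠ (Lc : ℤ) - 1 → c₂ + (Ψ₂ (n + 1) - Ψ₂ n) = 0) →
      ∀ (p : Site (d + 1)) (a : Fib d),
        (∑' q : Site (d + 1), (c₁ + (Ψ₁ (q β + 1) - Ψ₁ (q β))) * ∑' u : Site (d + 1), (c₂ + (Ψ₂ (u ν + 1) - Ψ₂ (u ν))) * S ν u q p (Sum.inl β) a) +
          ∑' q : Site (d + 1), (c₂ + (Ψ₂ (q ν + 1) - Ψ₂ (q ν))) * ∑' u : Site (d + 1), (c₁ + (Ψ₁ (u β + 1) - Ψ₁ (u β))) * S β u q p (Sum.inl ν) a = 0)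
    (c : ℝ) (Φ : ℤ → ℝ) {B : ℝ} (hΦ : ∀ s, |Φ s| ≤ B) (c' : ℝ) (Φ' : ℤ → ℝ) {B' : ℝ} (hΦ' : ∀ s, |Φ' s| ≤ B') (y : Site (d + 1)) (a' : Fib d) :
    (∑' w : Site (d + 1), (c + (Φ (w β + 1) - Φ (w β))) * ∑' t : Site (d + 1), (c' + (Φ' (t ν + 1) - Φ' (t ν))) *
        e3OfK Lc (GcombSh (d := d) Lc j) S ν t w y (Sum.inl β) a') +
      ∑' w : Site (d + 1), (c' + (Φ' (w ν + 1) - Φ' (w ν))) * ∑' t : Site (d + 1), (c + (Φ (t β + 1) - Φ (t β))) *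
        e3OfK Lc (GcombSh (d := d) Lc j) S β t w y (Sum.inl ν) a' = 0 := by
  obtain ⟨δK', CK', hδK', _, hG⟩ := decays_GcombSh (d := d) Lc j
  exact sym_e3OfK_of_wardLetters hG hδK' (trK_GcombSh (d := d) (Lc := Lc) j) (cH := (stepScale d Lc j * (Lc : ℝ) ^ (d + 1))⁻¹)
    (fun a f B hf κ u => tsum_coord_colH_GcombSh Lc j a f hf κ u) (fun a f B hf m q => tsum_coord_mm_GcombSh Lc j a f hf m q)
    hS hδs ν β hyp c Φ hΦ c' Φ' hΦ' y a'

end CombStep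

end Summit.QuantumFields.BalabanUV.Beta.GAN24.CubicSectorCurrentSymOfWardLetters

end
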